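import Mathlib.Analysis.SpecialFunctions.Integrals.Basic
import Mathlib.Analysis.SpecialFunctions.Trigonometric.Bounds
import Mathlib.Analysis.Complex.ExponentialBounds
import Mathlib.Analysis.Real.Pi.Bounds
import Literature.Computability.Cryptography.LWEGaussMass
import HarnessLib

/-!
# The discretised Gaussian is bounded away from uniform at zero: `Ψ̄_α(0) ≥ (1 + 1/40)/q`

For Regev's noise `Ψ̄_α` on `ℤ_q` (`LWE.discretizedGaussian`), every modulus `q ≥ 2` and every
noise rate `α ∈ (0, 1)`,

  `Ψ̄_α(0) ≥ (1 + 1/40) · (1/q)`        (`discretizedGaussian_zero_ge`),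

uniformly in `α` — the quantitative form of "for `α < 1`, `Ψ̄_α` is far from uniform" behind the
easy direction (search ⇒ decision) of Regev 2009, §4 (`LWESearchToDecision.lean`, hypothesis
`hgauss` with `k = 40`).  Proof: for `α ≤ 3/8` the central window alone carries mass
`∫_{-u}^{u} e^{-π t²} dt`, `u = 1/(2qα) ≥ 4/(3q)`, estimated by Riemann lower sums; for
`α ≥ 3/8` all windows are summed by the theta identity (`LWEGaussTheta.lean`,
`LWEGaussMass.lean`) and the cosine series is bounded below by
`1 + 2e^{-a} cos(2π y) - 2e^{-4a}/(1 - e^{-5a})`, `a = π α² ∈ [9π/64, π)`, whose window integral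
is `≥ (1/q)(1 - 2e^{-4a}/(1-e^{-5a}) + (4/π) e^{-a}) ≥ (1 + 1/40)/q` (Jordan's inequality
`sin(π/q) ≥ 2/q` and the numerical values `e^{-π} > 0.0423`, `e^{-a} ≤ 0.65`).

## References

* O. Regev, *On lattices, learning with errors, random linear codes, and cryptography*, J. ACM 56
  (2009), §2, §4 [RegevLWE2009].
-/

noncomputable section

open MeasureTheory Real Set intervalIntegral
open scoped ENNReal

namespace Literature.Computability.Cryptography

namespace LWE

/-! ### Numerical constants -/

/-- `e^{-π} > 0.0423`. [folklore] -/
theorem exp_neg_pi_gt : (423 / 10000 : ℝ) < Real.exp (-π) := by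
  have h1 : Real.exp (-(315 / 100 : ℝ)) < Real.exp (-π) := Real.exp_lt_exp.2 (by linarith [pi_lt_d2])
  refine lt_trans ?_ h1
  have h2 : Real.exp (-(315 / 100 : ℝ)) = Real.exp (-1) ^ 3 * Real.exp (-(15 / 100 : ℝ)) := by
    rw [← Real.exp_nat_mul, ← Real.exp_add]
    norm_num
  rw [h2]
  have h3 := Real.exp_neg_one_gt_d9
  have h4 : (85 / 100 : ℝ) ≤ Real.exp (-(15 / 100 : ℝ)) := by
    have := Real.add_one_le_exp (-(15 / 100 : ℝ))
    linarith
  have h5 : (0.36787944116 : ℝ) ^ 3 < Real.exp (-1) ^ 3 :=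
    pow_lt_pow_left₀ h3 (by norm_num) three_ne_zero
  nlinarith [h5, h4, pow_pos (Real.exp_pos (-1)) 3]

/-- `e^{-π/16} ≥ 0.803125`. [folklore] -/
theorem exp_neg_pi_div_sixteen_ge : (803125 / 1000000 : ℝ) ≤ Real.exp (-(π / 16)) := by
  have := Real.add_one_le_exp (-(π / 16))
  linarith [pi_lt_d2]

/-- `e^{-π/4} ≥ 0.416`. [folklore] -/
theorem exp_neg_pi_div_four_ge : (416 / 1000 : ℝ) ≤ Real.exp (-(π / 4)) := by
  have h : Real.exp (-(π / 4)) = Real.exp (-(π / 16)) ^ 4 := by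
    rw [← Real.exp_nat_mul]
    congr 1
    ring
  rw [h]
  refine le_trans (by norm_num) (pow_le_pow_left₀ (by norm_num) exp_neg_pi_div_sixteen_ge 4)

/-- For `a ≥ 9π/64`, `e^{-a} ≤ 0.65`. [folklore] -/
theorem exp_neg_le_of_ge {a : ℝ} (ha : 9 * π / 64 ≤ a) : Real.exp (-a) ≤ 65 / 100 := by
  have ha' : (4415 / 10000 : ℝ) ≤ a := by linarith [pi_gt_d2]
  have hq := Real.quadratic_le_exp_of_nonneg (show (0 : ℝ) ≤ a by linarith)
  have hexp : (100 / 65 : ℝ) ≤ Real.exp a := by nlinarith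
  rw [Real.exp_neg, inv_le_comm₀ (Real.exp_pos a) (by norm_num)]
  simpa using hexp

/-- **The gap of the cosine-series minorant.** For `a ∈ [9π/64, π)`,
`(4/π) e^{-a} - 2 e^{-4a}/(1 - e^{-5a}) ≥ 1/40`. [folklore] -/
theorem thetaGap_ge {a : ℝ} (ha : 9 * π / 64 ≤ a) (ha' : a < π) :
    (1 : ℝ) / 40 ≤ 4 / π * Real.exp (-a) - 2 * (Real.exp (-4 * a) / (1 - Real.exp (-5 * a))) := by
  set x := Real.exp (-a) with hx
  have hx0 : 0 < x := Real.exp_pos _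
  have hxlo : (423 / 10000 : ℝ) ≤ x := (exp_neg_pi_gt.trans (Real.exp_lt_exp.2 (by linarith))).le
  have hxhi : x ≤ 65 / 100 := exp_neg_le_of_ge ha
  have h4 : Real.exp (-4 * a) = x ^ 4 := by
    rw [hx, ← Real.exp_nat_mul]; congr 1; push_cast; ring
  have h5 : Real.exp (-5 * a) = x ^ 5 := by
    rw [hx, ← Real.exp_nat_mul]; congr 1; push_cast; ring
  rw [h4, h5]
  have hx3 : x ^ 3 ≤ (65 / 100 : ℝ) ^ 3 := pow_le_pow_left₀ hx0.le hxhi 3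
  have hx5 : x ^ 5 ≤ (65 / 100 : ℝ) ^ 5 := pow_le_pow_left₀ hx0.le hxhi 5
  have hden : (8839709375 / 10000000000 : ℝ) ≤ 1 - x ^ 5 := by norm_num at hx5 ⊢; linarith
  have hnum : x ^ 4 ≤ (274625 / 1000000 : ℝ) * x := by
    have : x ^ 4 = x ^ 3 * x := by ring
    rw [this]
    norm_num at hx3 ⊢
    nlinarith
  have hfrac : x ^ 4 / (1 - x ^ 5) ≤ (274625 / 1000000 : ℝ) * x / (8839709375 / 10000000000) :=
    div_le_div₀ (by positivity) hnum (by norm_num) hden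
  have hpi : 4 / (3.15 : ℝ) * x ≤ 4 / π * x :=
    mul_le_mul_of_nonneg_right (div_le_div_of_nonneg_left (by norm_num) pi_pos pi_lt_d2.le) hx0.le
  norm_num at hfrac hpi ⊢
  nlinarith [hfrac, hpi, hxlo]

/-! ### The central Gaussian window integral `∫_{-u}^{u} e^{-π t²} dt` -/

/-- Riemann lower bound: a constant minorant on `[a, b]` integrates below `e^{-π t²}`. [folklore] -/
theorem const_mul_le_integral_exp {a b c : ℝ} (hab : a ≤ b)
    (h : ∀ t ∈ Icc a b, c ≤ Real.exp (-π * t ^ 2)) :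
    (b - a) * c ≤ ∫ t in a..b, Real.exp (-π * t ^ 2) := by
  have hconst := intervalIntegral.integral_const (a := a) (b := b) c
  rw [smul_eq_mul] at hconst
  rw [← hconst]
  exact intervalIntegral.integral_mono_on hab intervalIntegrable_const
    ((by fun_prop : Continuous fun t : ℝ => Real.exp (-π * t ^ 2)).intervalIntegrable _ _) h

/-- `∫_{-u}^{u} e^{-π t²} dt ≥ 2u e^{-π u²}` for `u ≥ 0`. [folklore] -/
theorem mul_exp_le_integral_exp {u : ℝ} (hu : 0 ≤ u) :
    2 * u * Real.exp (-π * u ^ 2) ≤ ∫ t in -u..u, Real.exp (-π * t ^ 2) := by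
  have h := const_mul_le_integral_exp (c := Real.exp (-π * u ^ 2)) (show -u ≤ u by linarith)
    (fun t ht => Real.exp_le_exp.2 (by
      have := sq_le_sq' ht.1 ht.2
      nlinarith [pi_pos]))
  linarith

/-- `u ↦ ∫_{-u}^{u} e^{-π t²} dt` is monotone on `u ≥ 0`. [folklore] -/
theorem integral_exp_mono {u u' : ℝ} (hu : 0 ≤ u) (h : u ≤ u') :
    ∫ t in -u..u, Real.exp (-π * t ^ 2) ≤ ∫ t in -u'..u', Real.exp (-π * t ^ 2) :=
  intervalIntegral.integral_mono_interval (by linarith) (by linarith) h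
    (Filter.Eventually.of_forall fun t => (Real.exp_pos _).le)
    ((by fun_prop : Continuous fun t : ℝ => Real.exp (-π * t ^ 2)).intervalIntegrable _ _)

/-- `∫_{-1/2}^{1/2} e^{-π t²} dt ≥ 0.6095` (three Riemann pieces). [folklore] -/
theorem integral_exp_half_ge : (6095 / 10000 : ℝ) ≤ ∫ t in (-(1 / 2) : ℝ)..(1 / 2), Real.exp (-π * t ^ 2) := by
  have hint : ∀ a b : ℝ, IntervalIntegrable (fun t : ℝ => Real.exp (-π * t ^ 2)) volume a b :=
    fun a b => (by fun_prop : Continuous fun t : ℝ => Real.exp (-π * t ^ 2)).intervalIntegrable _ _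
  have hsplit : (∫ t in (-(1 / 2) : ℝ)..(1 / 2), Real.exp (-π * t ^ 2)) =
      (∫ t in (-(1 / 2) : ℝ)..(-(1 / 4)), Real.exp (-π * t ^ 2)) +
      ((∫ t in (-(1 / 4) : ℝ)..(1 / 4), Real.exp (-π * t ^ 2)) +
        ∫ t in (1 / 4 : ℝ)..(1 / 2), Real.exp (-π * t ^ 2)) := by
    rw [intervalIntegral.integral_add_adjacent_intervals (hint _ _) (hint _ _),
      intervalIntegral.integral_add_adjacent_intervals (hint _ _) (hint _ _)]
  have houter : ∀ t : ℝ, t ∈ Icc (-(1 / 2)) (-(1 / 4)) ∨ t ∈ Icc (1 / 4) (1 / 2) →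
      (416 / 1000 : ℝ) ≤ Real.exp (-π * t ^ 2) := by
    intro t ht
    refine exp_neg_pi_div_four_ge.trans (Real.exp_le_exp.2 ?_)
    have : t ^ 2 ≤ 1 / 4 := by
      rcases ht with ⟨h1, h2⟩ | ⟨h1, h2⟩ <;> nlinarith
    nlinarith [pi_pos]
  have hinner : ∀ t ∈ Icc (-(1 / 4) : ℝ) (1 / 4), (803125 / 1000000 : ℝ) ≤ Real.exp (-π * t ^ 2) := by
    intro t ht
    refine exp_neg_pi_div_sixteen_ge.trans (Real.exp_le_exp.2 ?_)
    have : t ^ 2 ≤ 1 / 16 := by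
      obtain ⟨h1, h2⟩ := ht
      nlinarith
    nlinarith [pi_pos]
  have h1 := const_mul_le_integral_exp (show (-(1 / 2) : ℝ) ≤ -(1 / 4) by norm_num)
    fun t ht => houter t (Or.inl ht)
  have h2 := const_mul_le_integral_exp (show (-(1 / 4) : ℝ) ≤ 1 / 4 by norm_num) hinner
  have h3 := const_mul_le_integral_exp (show (1 / 4 : ℝ) ≤ 1 / 2 by norm_num)
    fun t ht => houter t (Or.inr ht)
  rw [hsplit]
  norm_num at h1 h2 h3 ⊢
  linarith

/-! ### Small noise: the central window suffices -/

/-- **Small noise (`α ≤ 3/8`).** `Ψ̄_α(0) ≥ (1 + 1/40)/q` from the central window alone.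
[cite: RegevLWE2009, §2] -/
theorem le_discretizedGaussian_zero_of_le {q : ℕ} [NeZero q] {α : ℝ} (hq : 2 ≤ q) (hα0 : 0 < α)
    (hα : α ≤ 3 / 8) : (1 + 1 / 40) / (q : ℝ) ≤ (discretizedGaussian q α 0).toReal := by
  have hq' : (2 : ℝ) ≤ q := by exact_mod_cast hq
  set u : ℝ := 1 / (2 * (q : ℝ)) / α with hu
  have hu0 : 0 < u := by positivity
  have hwin : ENNReal.ofReal (∫ t in -u..u, Real.exp (-π * t ^ 2)) ≤ discretizedGaussian q α 0 :=
    le_discretizedGaussian_zero_window hα0 (q := q)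
  rw [← ENNReal.ofReal_le_iff_le_toReal (PMF.apply_ne_top _ _)]
  refine le_trans (ENNReal.ofReal_le_ofReal ?_) hwin
  rcases le_or_gt (1 / 2) u with hbig | hsmall
  · -- `u ≥ 1/2`: the integral is `≥ ∫_{-1/2}^{1/2} ≥ 0.6095 ≥ 41/80 ≥ (1 + 1/40)/q`
    refine le_trans ?_ ((integral_exp_half_ge).trans (integral_exp_mono (by norm_num) hbig))
    rw [div_le_iff₀ (by positivity)]
    nlinarith
  · -- `u < 1/2`: the integral is `≥ 2u e^{-π/4} ≥ 0.832 u = 0.416/(qα) ≥ 1.109/q`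
    refine le_trans ?_ (mul_exp_le_integral_exp hu0.le)
    have hexp : (416 / 1000 : ℝ) ≤ Real.exp (-π * u ^ 2) := by
      refine exp_neg_pi_div_four_ge.trans (Real.exp_le_exp.2 ?_)
      have : u ^ 2 ≤ 1 / 4 := by nlinarith
      nlinarith [pi_pos]
    have huq : u * ((q : ℝ) * α) = 1 / 2 := by
      rw [hu]
      field_simp
    have hqα : 0 < (q : ℝ) * α := by positivity
    -- compare after multiplying by `q α`
    have key : (1 + 1 / 40) / (q : ℝ) * ((q : ℝ) * α) ≤ 2 * u * Real.exp (-π * u ^ 2) * ((q : ℝ) * α) := by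
      rw [show (1 + 1 / 40) / (q : ℝ) * ((q : ℝ) * α) = (1 + 1 / 40) * α by field_simp,
        show 2 * u * Real.exp (-π * u ^ 2) * ((q : ℝ) * α) = 2 * (u * ((q : ℝ) * α)) * Real.exp (-π * u ^ 2)
          by ring, huq]
      nlinarith
    exact le_of_mul_le_mul_right key hqα

/-! ### Large noise: all windows and the theta minorant -/

/-- The window integral of `C + D cos(2π y)` over `(-w, w)`: `2w C + D sin(2π w)/π`. [folklore] -/
theorem integral_window_cos (C D w : ℝ) :
    ∫ y in -w..w, (C + D * Real.cos (2 * π * y)) = 2 * w * C + D * Real.sin (2 * π * w) / π := by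
  have hc : IntervalIntegrable (fun _ : ℝ => C) volume (-w) w := intervalIntegrable_const
  have hcos : IntervalIntegrable (fun y : ℝ => D * Real.cos (2 * π * y)) volume (-w) w :=
    ((by fun_prop : Continuous fun y : ℝ => D * Real.cos (2 * π * y))).intervalIntegrable _ _
  rw [intervalIntegral.integral_add hc hcos, intervalIntegral.integral_const,
    intervalIntegral.integral_const_mul, intervalIntegral.integral_comp_mul_left _ (by positivity),
    integral_cos, smul_eq_mul, smul_eq_mul]
  rw [show 2 * π * -w = -(2 * π * w) by ring, Real.sin_neg]
  field_simp
  ring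

/-- **Large noise (`3/8 ≤ α < 1`).** `Ψ̄_α(0) ≥ (1 + 1/40)/q` from all windows through the
theta minorant. [cite: RegevLWE2009, §2] -/
theorem le_discretizedGaussian_zero_of_ge {q : ℕ} [NeZero q] {α : ℝ} (hq : 2 ≤ q) (hα : 3 / 8 ≤ α)
    (hα1 : α < 1) : (1 + 1 / 40) / (q : ℝ) ≤ (discretizedGaussian q α 0).toReal := by
  have hq' : (2 : ℝ) ≤ q := by exact_mod_cast hq
  have hα0 : 0 < α := by linarith
  set a : ℝ := π * α ^ 2 with ha_def
  have ha : 9 * π / 64 ≤ a := by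
    have hsq : (3 / 8 : ℝ) ^ 2 ≤ α ^ 2 := pow_le_pow_left₀ (by norm_num) hα 2
    rw [ha_def]
    nlinarith [pi_pos, hsq]
  have ha' : a < π := by
    rw [ha_def]
    have : α ^ 2 < 1 := by nlinarith
    nlinarith [pi_pos]
  set R : ℝ := Real.exp (-4 * a) / (1 - Real.exp (-5 * a)) with hR
  set w : ℝ := 1 / (2 * (q : ℝ)) with hw
  have hw0 : 0 < w := by positivity
  have hw4 : w ≤ 1 / 4 := by
    rw [hw, div_le_div_iff₀ (by positivity) (by positivity)]
    linarith
  have hgap := thetaGap_ge ha ha'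
  have hx0 : 0 < Real.exp (-a) := Real.exp_pos _
  have hxle : Real.exp (-a) ≤ 65 / 100 := exp_neg_le_of_ge ha
  have hR2 : 2 * R ≤ 1 := by
    have : 4 / π * Real.exp (-a) ≤ 4 / π * (65 / 100) := mul_le_mul_of_nonneg_left hxle (by positivity)
    have hpi : 4 / π ≤ 4 / (3.14 : ℝ) :=
      div_le_div_of_nonneg_left (by norm_num) (by norm_num) pi_gt_d2.le
    norm_num at hpi
    nlinarith
  -- the minorant
  set g : ℝ → ℝ := fun y => (1 - 2 * R) + 2 * Real.exp (-a) * Real.cos (2 * π * y) with hg_def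
  have hg0 : ∀ y ∈ Ioo (-w) w, 0 ≤ g y := by
    intro y hy
    rw [Set.mem_Ioo] at hy
    have hcos : 0 ≤ Real.cos (2 * π * y) := Real.cos_nonneg_of_mem_Icc ⟨by nlinarith [pi_pos], by
      nlinarith [pi_pos]⟩
    simp only [hg_def]
    nlinarith
  have hgi : IntegrableOn g (Ioo (-w) w) :=
    ((by simp only [hg_def]; fun_prop : Continuous g).integrableOn_Icc).mono_set Ioo_subset_Icc_self
  have hgle : ∀ y ∈ Ioo (-w) w,
      g y ≤ ∑' n : ℤ, Real.exp (-π * α ^ 2 * n ^ 2) * Real.cos (2 * π * n * y) := by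
    intro y _
    have hs := summable_thetaCos hα0.ne' y
    have heq : (fun n : ℤ => Real.exp (-a * n ^ 2) * Real.cos (2 * π * n * y)) =
        fun n : ℤ => Real.exp (-π * α ^ 2 * n ^ 2) * Real.cos (2 * π * n * y) := by
      funext n
      rw [ha_def, neg_mul, neg_mul, neg_mul, mul_assoc]
    have h := thetaCos_ge (a := a) (by positivity) y (by rw [heq]; exact hs)
    rw [heq, ← hR] at h
    simp only [hg_def]
    linarith [h]
  have hmain := le_discretizedGaussian_zero_periodic hα0 hg0 hgi hgle
  -- evaluate the window integral of the minorant
  have hint : ∫ y in Ioo (-w) w, g y = 2 * w * (1 - 2 * R) + 2 * Real.exp (-a) * Real.sin (2 * π * w) / π := by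
    rw [← integral_Ioc_eq_integral_Ioo, ← intervalIntegral.integral_of_le (by linarith)]
    exact integral_window_cos _ _ _
  rw [hint] at hmain
  rw [← ENNReal.ofReal_le_iff_le_toReal (PMF.apply_ne_top _ _)]
  refine le_trans (ENNReal.ofReal_le_ofReal ?_) hmain
  -- Jordan: `sin(2π w) = sin(π/q) ≥ 2/q = 4 w`
  have hsin : 4 * w ≤ Real.sin (2 * π * w) := by
    have h := Real.mul_le_sin (x := 2 * π * w) (by positivity) (by nlinarith [pi_pos])
    have : 2 / π * (2 * π * w) = 4 * w := by
      field_simp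
      ring
    linarith
  have h2w : 2 * w = 1 / (q : ℝ) := by rw [hw]; field_simp
  calc (1 + 1 / 40) / (q : ℝ) = 2 * w * (1 + 1 / 40) := by rw [h2w]; ring
    _ ≤ 2 * w * (1 - 2 * R + 4 / π * Real.exp (-a)) := by
        refine mul_le_mul_of_nonneg_left ?_ (by positivity)
        linarith [hgap]
    _ = 2 * w * (1 - 2 * R) + 2 * Real.exp (-a) * (4 * w) / π := by ring
    _ ≤ 2 * w * (1 - 2 * R) + 2 * Real.exp (-a) * Real.sin (2 * π * w) / π := by
        gcongr

/-! ### Main estimate -/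

/-- **`Ψ̄_α(0) ≥ (1 + 1/40)/q` for `q ≥ 2`, `0 < α < 1`** (uniformly in `α`): Regev's discretised
Gaussian gives the residue `0` noticeably more than its uniform share.  This is the noise estimate
`hgauss` (with `k = 40`) of the search-to-decision reduction `regev_search_to_decision_of_machine`.
[cite: RegevLWE2009, §2 and §4] -/
theorem discretizedGaussian_zero_ge (q : ℕ) [NeZero q] (α : ℝ) (hq : 2 ≤ q) (hα0 : 0 < α)
    (hα1 : α < 1) : (1 + 1 / (40 : ℝ)) / q ≤ (discretizedGaussian q α 0).toReal := by
  rcases le_or_gt α (3 / 8) with h | h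
  · exact le_discretizedGaussian_zero_of_le hq hα0 h
  · exact le_discretizedGaussian_zero_of_ge hq h.le hα1

end LWE

end Literature.Computability.Cryptography

end
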